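import Summits.Schanuel.Schanuel.Theorems.KhovanskiiApproxType.Negative.NonUniform
import Summits.Schanuel.Schanuel.Theorems.DiophantineDichotomyKhovanskiiApproxTypeEvDefs

/-!
# Negative lemma for crux `KhovanskiiApproxTypeEv` (stmt-Schanuel-14972): even eventually in the
# height, the constants cannot be uniform in the point (tightness)

Sibling of `Theorems/KhovanskiiApproxType/Negative/NonUniform.lean` (crux 6116, all heights), whose
degenerating Lambert family is re-used: the free Khovanskii points `s_k = (x_k, √2 x_k)`,
`k x_k e^{x_k} = 1`, `0 < x_k ≤ 1/k` (`isFreeKhovanskii_lambert`, `linearIndependent_lambert`,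
`exists_lambert`) accumulate at the ALGEBRAIC point `(0, 0, 1, 1)`, an admissible challenger at level
`(d, H) = (1, H)` for EVERY height `H ≥ 1`.

* `not_khovanskiiApproxTypeEvUniform`: the eventual crux with `(a, b, C)` AND the thresholds `H₀(d)`
  chosen uniformly in the point is false — at `d = 1`, past the uniform threshold `H₀(1)`, the bound
  `exp(−C(log H + 1))` is a fixed positive number while `‖(0,0,1,1) − θ_k‖ ≤ 2√2/k → 0`.

What is NOT refuted (and why): uniform `(a, b, C)` with POINT-DEPENDENT thresholds `H₀(d, s)`.  Along
the Lambert family the challenger `(0, 0, 1, 1)` sits at a fixed distance from each `θ_k`, so a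
threshold `H₀(1, s_k) ≫ exp(dist⁻¹)` outruns it; a refutation of that variant needs a family of free
Khovanskii points whose intrinsic simultaneous exponent at some FIXED degree is unbounded (unbounded
heights), which is the same unconstructed object as a kill of the crux itself.  So in the eventual form
the moral for provers is weaker than for 6116: `C(θ)` must blow up near algebraic points UNLESS the
threshold `H₀(d, θ)` is allowed to blow up instead — the eventual form can trade constant for threshold.
-/

noncomputable section

set_option linter.dupNamespace false

namespace Summit.Schanuel.Schanuel.Cruxes.KhovanskiiApproxTypeEv.Negative

open Summit.Schanuel.Schanuel.Cruxes.KhovanskiiApproxType.LwSmallHeight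
open Summit.Schanuel.Schanuel.Cruxes.KhovanskiiApproxType.Negative
open Polynomial

/-- The eventual crux with constants `(a, b, C)` AND thresholds `H₀(d)` UNIFORM in the point
(natural strengthening). -/
def KhovanskiiApproxTypeEvUniform : Prop :=
  ∀ n : ℕ, 2 ≤ n → ∃ a b C : ℝ, a < 1 / ((n : ℝ) - 1) ∧ 0 < C ∧ ∀ d : ℕ, ∃ H₀ : ℕ,
    ∀ s : Fin n → ℂ, LinearIndependent ℚ s → IsFreeKhovanskii n s →
    ∀ (H : ℕ) (γ : Fin n ⊕ Fin n → ℂ), H₀ ≤ H →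
      Module.finrank ℚ ↥(IntermediateField.adjoin ℚ (Set.range γ)) ≤ d →
      (∀ i, ∃ P : Polynomial ℤ, P ≠ 0 ∧ P.natDegree ≤ d ∧ (∀ k, |P.coeff k| ≤ (H : ℤ)) ∧
        Polynomial.aeval (γ i) P = 0) →
      Real.exp (-(C * ((d : ℝ) ^ a * Real.log H + (d : ℝ) ^ b))) ≤ ‖γ - Sum.elim s (Complex.exp ∘ s)‖

set_option maxHeartbeats 400000 in
/-- **Even eventually in the height, `(a, b, C; H₀)` cannot be uniform in the point** (tightness):
at `d = 1` and any height `H ≥ max(H₀(1), 1)` the algebraic point `(0, 0, 1, 1)` is an admissible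
challenger, at distance `≤ 2√2/k < exp(−C(log H + 1))` from `θ_k = (x_k, √2 x_k, e^{x_k}, e^{√2 x_k})`
for `k > 3 exp(C(log H + 1))`, where `s_k = (x_k, √2 x_k)`, `k x_k e^{x_k} = 1`, is a free Khovanskii
point with `ℚ`-linearly independent coordinates. [folklore] -/
theorem not_khovanskiiApproxTypeEvUniform : ¬ KhovanskiiApproxTypeEvUniform := by
  intro h
  obtain ⟨a, b, C, -, hC, hall⟩ := h 2 le_rfl
  obtain ⟨H₀, hH₀⟩ := hall 1
  -- the height and the (positive, point-free) bound at level (1, H)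
  set H : ℕ := max H₀ 1 with hHdef
  have hH1 : 1 ≤ H := le_max_right _ _
  have hH1r : (1 : ℝ) ≤ H := by exact_mod_cast hH1
  have hlogH : 0 ≤ Real.log H := Real.log_nonneg hH1r
  set B : ℝ := Real.exp (-(C * (Real.log H + 1))) with hBdef
  have hBpos : 0 < B := Real.exp_pos _
  -- the Lambert point
  set k : ℕ := ⌈3 / B⌉₊ + 2 with hkdef
  have hk1 : 1 ≤ k := by omega
  have hk2 : (2 : ℝ) ≤ k := by exact_mod_cast (show 2 ≤ k by omega)
  have hkpos : (0 : ℝ) < k := by linarith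
  have hkB : 3 / B < k := by
    have := Nat.le_ceil (3 / B)
    have h' : (⌈3 / B⌉₊ : ℝ) + 2 = (k : ℝ) := by rw [hkdef]; push_cast; ring
    linarith
  obtain ⟨x, hx0, hxk, hx⟩ := exists_lambert k hk1
  have key := hH₀ _ (linearIndependent_lambert x hx0.ne') (isFreeKhovanskii_lambert k hk1 x hx hx0)
    H (Sum.elim ![0, 0] ![1, 1]) (le_max_left _ _) ?_ ?_
  · -- distance bound (as in `not_khovanskiiApproxTypeUniform`)
    have hx1 : x ≤ 1 := hxk.trans (by rw [div_le_one hkpos]; linarith)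
    have hsx : Real.sqrt 2 * x ≤ Real.sqrt 2 / k := by
      rw [div_eq_mul_one_div]; exact mul_le_mul_of_nonneg_left hxk (Real.sqrt_nonneg _)
    have hs2 : Real.sqrt 2 < 3 / 2 := by
      rw [Real.sqrt_lt' (by norm_num)]; norm_num
    have hs1 : 1 < Real.sqrt 2 := by
      rw [Real.lt_sqrt (by norm_num)]; norm_num
    have hsxpos : 0 < Real.sqrt 2 * x := by positivity
    have hsx1 : Real.sqrt 2 * x ≤ 1 := by
      calc Real.sqrt 2 * x ≤ Real.sqrt 2 / k := hsx
        _ ≤ Real.sqrt 2 / 2 := by gcongr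
        _ ≤ 1 := by linarith
    have hbound : ‖Sum.elim ![(0 : ℂ), 0] ![1, 1] -
        Sum.elim ![(x : ℂ), ((Real.sqrt 2 * x : ℝ) : ℂ)]
          (Complex.exp ∘ ![(x : ℂ), ((Real.sqrt 2 * x : ℝ) : ℂ)])‖ ≤ 2 * (Real.sqrt 2 / k) := by
      refine (pi_norm_le_iff_of_nonneg (by positivity)).mpr ?_
      have e1 : |Real.exp x - 1| ≤ 2 * |x| := Real.abs_exp_sub_one_le (by rw [abs_of_pos hx0]; exact hx1)
      have e2 : |Real.exp (Real.sqrt 2 * x) - 1| ≤ 2 * |Real.sqrt 2 * x| :=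
        Real.abs_exp_sub_one_le (by rw [abs_of_pos hsxpos]; exact hsx1)
      rw [abs_of_pos hx0] at e1
      rw [abs_of_pos hsxpos] at e2
      rintro (i | i) <;> fin_cases i
      · simp only [Pi.sub_apply, Sum.elim_inl]
        simp
        rw [abs_of_pos hx0]
        nlinarith
      · simp only [Pi.sub_apply, Sum.elim_inl]
        simp
        rw [abs_of_pos (Real.sqrt_pos.mpr (by norm_num : (0:ℝ) < 2)), abs_of_pos hx0]
        have : 0 ≤ Real.sqrt 2 / k := by positivity
        linarith
      · simp only [Pi.sub_apply, Sum.elim_inr, Function.comp]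
        simp
        rw [← Complex.ofReal_exp, ← Complex.ofReal_one, ← Complex.ofReal_sub, Complex.norm_real,
          Real.norm_eq_abs, abs_sub_comm]
        nlinarith
      · simp only [Pi.sub_apply, Sum.elim_inr, Function.comp]
        simp
        rw [← Complex.ofReal_mul, ← Complex.ofReal_exp, ← Complex.ofReal_one, ← Complex.ofReal_sub,
          Complex.norm_real, Real.norm_eq_abs, abs_sub_comm]
        linarith
    have hlhs : Real.exp (-(C * (((1:ℕ) : ℝ) ^ a * Real.log H + ((1:ℕ) : ℝ) ^ b))) = B := by
      rw [hBdef]; simp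
    rw [hlhs] at key
    have hfin : 2 * (Real.sqrt 2 / k) < B := by
      have h3k : 3 / (k : ℝ) < B := by
        rw [div_lt_iff₀ hkpos]
        have := (div_lt_iff₀ hBpos).mp hkB
        linarith
      have h22 : 2 * (Real.sqrt 2 / k) < 3 / (k : ℝ) := by
        rw [show 2 * (Real.sqrt 2 / k) = (2 * Real.sqrt 2) / (k : ℝ) by ring]
        exact div_lt_div_of_pos_right (by linarith) hkpos
      linarith
    linarith [key.trans hbound]
  · -- finrank: adjoin {0,1} = ⊥
    have : IntermediateField.adjoin ℚ (Set.range (Sum.elim ![(0:ℂ), 0] ![1, 1])) = ⊥ := by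
      rw [← le_bot_iff, IntermediateField.adjoin_le_iff]
      rintro _ ⟨i, rfl⟩
      rcases i with i | i <;> fin_cases i
      · exact zero_mem _
      · exact zero_mem _
      · exact one_mem _
      · exact one_mem _
    rw [this, IntermediateField.finrank_bot]
  · have hH1z : (1 : ℤ) ≤ H := by exact_mod_cast hH1
    rintro (i | i) <;> fin_cases i
    · exact ⟨X, X_ne_zero, by simp, fun k => by rw [coeff_X]; split_ifs <;> simp; omega, by simp⟩
    · exact ⟨X, X_ne_zero, by simp, fun k => by rw [coeff_X]; split_ifs <;> simp; omega, by simp⟩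
    · refine ⟨X - Polynomial.C 1, X_sub_C_ne_zero 1, by rw [natDegree_X_sub_C], fun k => ?_, by simp⟩
      rw [coeff_sub, coeff_X, coeff_C]; split_ifs <;> simp <;> omega
    · refine ⟨X - Polynomial.C 1, X_sub_C_ne_zero 1, by rw [natDegree_X_sub_C], fun k => ?_, by simp⟩
      rw [coeff_sub, coeff_X, coeff_C]; split_ifs <;> simp <;> omega

end Summit.Schanuel.Schanuel.Cruxes.KhovanskiiApproxTypeEv.Negative

end
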